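import Summits.QuantumFields.YangMills.Theorems.BalabanUVNodesN06AtRecord11ObligationsPins4
import Literature.MathematicalPhysics.QuantumFieldTheory.Balaban1983to89.B9RWSums343HolderGp

/-!
# BalabanUVNodes ∕ N06 ([B9], `Dag.B9_main`) — OBLIGATIONS OF THE STAGE-11 CERTIFICATE KNIT AT THE RECORD, XI-e: `t310` AND `t37` AT THE ALL-BLOCKS PINS
# WITH THE (3.43) HÖLDER MEMBER OF THE RANDOM-WALK SUMS PROVED (seat n06-k's `B9RWSums343Holder` ∕ `B9RWSums343HolderGp`)

Track A of `YM-PLAN.md` (cell `pub-ymgap`, HUMAN RULING D-0062), node **N06** = [Balaban1985BackgroundPropagators] Thms 3.1–3.15; seat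
`pub-ymgap-dag-n06-d` gen 3 = dag-lead N06-ASSIGNMENT v1 (P3) «THE KNIT AT THE RECORD».  Companion of `…ObligationsPins4` (per-row lemmas at `ops : OpsY N θ₃ M⋆`).

THE POINT.  In `…Pins4.t310_of_allPin` ∕ `t37_of_allPin` (rows 19 ∕ 18 at the all-blocks pins `(ops x).E310 = W310OfOps … (ConvAll3107 … (ops x).GA B₁ δ₁ B(·) B′(·) B′(·,·))`,
`(ops x).E37 = E37AllOfOps (W38OfOps …) … (ops x).Gp B₁ δ₁ …`) the residuals `hrest` displayed, besides (3.46)₃,₄,₅, the WHOLE Hölder block `B9.Ineq343_345 … = (3.43) ∧ (3.44) ∧ (3.45)`.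
Seat n06-k's `thm310Printed_allPin_schur_holder` (p474790) ∕ `thm37Printed_allPin_schur_holder` (p475516) PROVE the (3.43) member of the random-walk sums (3.107) G(U) ∕ (3.90) G′(U)
inside the leaves — Cor. 3.6's (3.43) for the head terms h_□G_□(U)h_□ ∕ h_□G′_□(U)h_□ read through the PROBE LETTERS of (3.40) (`HolderProbes`; `HolderLegs310` ∕ `HolderLegs37`,
localized on `S_H(□)` with overlap count `N_H`), the transposed factors R♯_a(U) ∕ the V-terms through the probes (`FactorsHolder310` ∕ `HolderV37`), the co-reading `H1Reads` of
`K.h1`, summed by [4] Lemma 2.1 (2.61) — so that only (3.44), (3.45) and (3.46)₃,₄,₅ stay displayed (cell GAPS G-B9-02∕07: their input side is not in print).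

WHAT THIS MODULE DOES (kernel bookkeeping; 0 `def`, 0 `sorry`, standard axioms; COUNT-NEUTRAL, `--supports` K1′ `StabilityBAtRecordR12e`), at `I := MemberY`, `geo9Y`,
`bg9Y (M_N ℂ) SU(N)`, `c35Y`: ★ `t310_of_allPin_holder`, ★ `t37_of_allPin_holder` — `B9.Thm310Printed …(fun x => (ops x).E310)` ∕ `B9.Thm37Printed … (fun x => (ops x).E37)` at the
all-blocks pins from the inputs of `t310_of_allPin` ∕ `t37_of_allPin` PLUS the probe letters `𝔭`, the head-support sets `SH` with count `NH`, the Hölder constants `Bl θH` ∕ `Bl BV`,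
the co-reading `hH1`, ONE more operator-level package `h36H` (Cor. 3.6's Hölder legs + the probe-read factors ∕ V-terms, AT THE SAME thresholds `M₁ a₁` and rate `δ₀` as `h36`;
n06-k's Hölder∕(2.61) parameters are taken `d₁ := d`, `δ₁ := δ₀`, `α₁ := α`, so `h261` serves both and `(1−2α)δ₀ ≤ (1−α)δ₀` is arithmetic), the constant relation
`hBβ : holderConst d δ₀ α N_H (N_F ∕ N′) C (Bl β) (θH β ∕ BV β) ≤ B(β)` — and `hrest` WITHOUT its (3.43) conjunct.

HONEST FRAMING.  Kernel bookkeeping at pinned readings over displayed hypothesis schemas of printed ∕ located shape; nothing of [B9] is proved for Bałaban's operators; N06 is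
NOT discharged.  One finite four-torus programme at fixed `ε` — NOT ℝ⁴, NOT OS, NOT a mass gap, NOT Clay.  No `def`.
-/


noncomputable section

namespace Summit.QuantumFields.YangMills.BalabanUVNodes.N06AtRecord11ObligationsPins5

open Literature.MathematicalPhysics.QuantumFieldTheory.Balaban1983to89
open Literature.MathematicalPhysics.QuantumFieldTheory.Balaban1983to89.Node00
open Literature.MathematicalPhysics.QuantumFieldTheory.Balaban1983to89.B9PinMembersKLevelV1 (MemberY geo9Y bg9Y)
open Literature.MathematicalPhysics.QuantumFieldTheory.Balaban1983to89.B9PinGeometryKLevelV1 (c35Y c35Y_pos)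
open Literature.MathematicalPhysics.QuantumFieldTheory.Balaban1983to89.B7Prop2SpecialUnitary (specialUnitaryUnits)
open Literature.MathematicalPhysics.QuantumFieldTheory.Balaban1983to89.B9Thm34Ext (toB6)
open Literature.MathematicalPhysics.QuantumFieldTheory.Balaban1983to89.B6RandomWalk (Ineq261)
open Literature.MathematicalPhysics.QuantumFieldTheory.Balaban1983to89.B9Thm37Whole (Ops Sizes StaticOK Local342 Identities const37)
open Literature.MathematicalPhysics.QuantumFieldTheory.Balaban1983to89.B9Cor38Whole
open Literature.MathematicalPhysics.QuantumFieldTheory.Balaban1983to89.B9Thm37GlueCor36 (CoRealizes)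
open Literature.MathematicalPhysics.QuantumFieldTheory.Balaban1983to89.B9Thm37Glue (IsTransposePair)
open Literature.MathematicalPhysics.QuantumFieldTheory.Balaban1983to89.B9Thm310Whole
open Literature.MathematicalPhysics.QuantumFieldTheory.Balaban1983to89.B9RWSums343to347Whole
open Literature.MathematicalPhysics.QuantumFieldTheory.Balaban1983to89.B9RWSums346Schur (L2Reads thm310Printed_allPin_schur thm37Printed_allPin_schur)
open Literature.MathematicalPhysics.QuantumFieldTheory.Balaban1983to89.B9GeoLemma21KLevelV1 (geo9Y_dist_comm geo9Y_len_pos)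
open Literature.MathematicalPhysics.QuantumFieldTheory.Balaban1983to89.B9GeoNormsKLevelV1 (geo9K_dist_nonneg)
open Summit.QuantumFields.YangMills.BalabanUVNodes.N06AtRecord11Obligations (const37_nonneg)
open scoped Matrix.Norms.L2Operator
open Literature.MathematicalPhysics.QuantumFieldTheory.Balaban1983to89.B9RWSums343Holder
  (HolderProbes H1Reads HolderLegs310 FactorsHolder310 holderConst thm310Printed_allPin_schur_holder)
open Literature.MathematicalPhysics.QuantumFieldTheory.Balaban1983to89.B9RWSums343HolderGp (HolderLegs37 HolderV37 thm37Printed_allPin_schur_holder)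

variable {N : ℕ} (θ₃ : Stage3Params) (Mstar : ℕ) (ops : OpsY N θ₃ Mstar)

/-- ★ **`t310` AT THE ALL-BLOCKS PIN, (3.43) MEMBER PROVED** `(ops x).E310 = W310OfOps (𝔬 x) (rd x) (ConvAll3107 (𝔬 x) (R x) (H x) C δ (ops x).GA B₁ δ₁ …)` (C = `const37 …`,
δ = (1−2α)δ₀): n06-k's inputs give Theorem 3.10 at `W310OfOps … (Conv3107 …)` (`thm310Printed_of_local3107`), and `thm310Printed_allPin_schur_holder` strengthens the predicate from
the co-readings of `(ops x).GA` (sup ∕ weighted ∕ L² ∕ Hölder-through-probes), the symmetry of G(U) and the transpose pair, `Facts347` for M ≧ M_g, Cor. 3.6's Hölder legs and the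
probe-read factors (`h36H`), the constants' relations (`hBβ` for the (3.43) constant) and the residual (3.44), (3.45), (3.46)₃,₄,₅ under the provisos — displayed.
[cite: Balaban1985BackgroundPropagators, Thm 3.10 (3.107)–(3.108) pp.414–416, Thm 3.10 ⇒ Thm 3.3 p.416, Cor. 3.6 p.408, (3.40) p.397, (3.42)–(3.47) pp.397–398; Balaban1984PropagatorsII, Lemma 2.1 (2.61) p.234] -/
theorem t310_of_allPin_holder [∀ x : MemberY θ₃.d₆ θ₃.ℓ₆ θ₃.hd' θ₃.hL' θ₃.b₀ θ₃.b₁ Mstar, Fintype (geo9Y x).Site] [∀ x : MemberY θ₃.d₆ θ₃.ℓ₆ θ₃.hd' θ₃.hL' θ₃.b₀ θ₃.b₁ Mstar, DecidableEq (geo9Y x).Site]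
    {X Y ι A PX PY : MemberY θ₃.d₆ θ₃.ℓ₆ θ₃.hd' θ₃.hL' θ₃.b₀ θ₃.b₁ Mstar → Type} [∀ x, Fintype (X x)] [∀ x, DecidableEq (X x)] [∀ x, Fintype (Y x)]
    [∀ x, DecidableEq (Y x)] [∀ x, Fintype (ι x)] [∀ x, Fintype (A x)] [∀ x, Fintype (PX x)] [∀ x, DecidableEq (PX x)] [∀ x, Fintype (PY x)] [∀ x, DecidableEq (PY x)]
    (𝔬 : ∀ x : MemberY θ₃.d₆ θ₃.ℓ₆ θ₃.hd' θ₃.hL' θ₃.b₀ θ₃.b₁ Mstar, Ops310 (geo9Y x) (bg9Y (Matrix (Fin N) (Fin N) ℂ) (specialUnitaryUnits (Fin N)) x) (X x) (Y x) (ι x) (A x))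
    (rd : ∀ x : MemberY θ₃.d₆ θ₃.ℓ₆ θ₃.hd' θ₃.hL' θ₃.b₀ θ₃.b₁ Mstar, WalkReading310 (geo9Y x) (bg9Y (Matrix (Fin N) (Fin N) ℂ) (specialUnitaryUnits (Fin N)) x) (X x) (ι x) (A x))
    (𝔭 : ∀ x : MemberY θ₃.d₆ θ₃.ℓ₆ θ₃.hd' θ₃.hL' θ₃.b₀ θ₃.b₁ Mstar, HolderProbes (geo9Y x) (bg9Y (Matrix (Fin N) (Fin N) ℂ) (specialUnitaryUnits (Fin N)) x) (X x) (Y x) (PX x) (PY x))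
    (SH : ∀ x : MemberY θ₃.d₆ θ₃.ℓ₆ θ₃.hd' θ₃.hL' θ₃.b₀ θ₃.b₁ Mstar, ι x → Finset (geo9Y x).Site) (Bl θH : ℝ → ℝ) (NH : ℝ)
    (R : MemberY θ₃.d₆ θ₃.ℓ₆ θ₃.hd' θ₃.hL' θ₃.b₀ θ₃.b₁ Mstar → ℝ) (H : MemberY θ₃.d₆ θ₃.ℓ₆ θ₃.hd' θ₃.hL' θ₃.b₀ θ₃.b₁ Mstar → Prop) (κ : MemberY θ₃.d₆ θ₃.ℓ₆ θ₃.hd' θ₃.hL' θ₃.b₀ θ₃.b₁ Mstar → Sizes310)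
    (d : ℕ) (α ρ Nc N' NF Cℓ K θ₀ B₀ δ₀ a₁ M₁ ML : ℝ)
    (hα : 0 ≤ α) (hα2 : α ≤ 1 / 2) (hN : 0 ≤ Nc) (hN' : 0 ≤ N') (hNF : 0 ≤ NF) (hCℓ : 1 ≤ Cℓ) (hK : 0 ≤ K) (hθ₀ : 0 ≤ θ₀) (hB₀ : 0 < B₀)
    (hδ₀ : 0 < δ₀) (ha₁ : 0 < a₁) (hM₁ : 0 < M₁) (hNH : 0 ≤ NH)
    (hst : ∀ x, StaticOK310 (𝔬 x) ρ Nc N' NF Cℓ (κ x)) (hκ : ∀ x, (κ x).Bounded K)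
    (hrd : ∀ x, (rd x).OK (𝔬 x).blk) (hloc : ∀ x, Locality310 (𝔬 x) (rd x))
    (h261 : ∀ x : MemberY θ₃.d₆ θ₃.ℓ₆ θ₃.hd' θ₃.hL' θ₃.b₀ θ₃.b₁ Mstar, ML ≤ (geo9Y x).M → Ineq261 d (toB6 (geo9Y x) (R x) (H x)) δ₀ α)
    (h36 : ∀ x : MemberY θ₃.d₆ θ₃.ℓ₆ θ₃.hd' θ₃.hL' θ₃.b₀ θ₃.b₁ Mstar, M₁ ≤ (geo9Y x).M → ∀ α₀ : ℝ, 0 < α₀ → c35Y * (geo9Y x).M * α₀ ≤ a₁ →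
      ∀ U : (bg9Y (Matrix (Fin N) (Fin N) ℂ) (specialUnitaryUnits (Fin N)) x).Cfg, (bg9Y (Matrix (Fin N) (Fin N) ℂ) (specialUnitaryUnits (Fin N)) x).Reg335 c35Y α₀ U →
        Local342G (𝔬 x) (R x) (H x) B₀ δ₀ U ∧ Factors389 (𝔬 x) (R x) (H x) θ₀ δ₀ U ∧ Identities310 (𝔬 x) (R x) (H x) U)
    (h36H : ∀ x : MemberY θ₃.d₆ θ₃.ℓ₆ θ₃.hd' θ₃.hL' θ₃.b₀ θ₃.b₁ Mstar, M₁ ≤ (geo9Y x).M → ∀ α₀ : ℝ, 0 < α₀ → c35Y * (geo9Y x).M * α₀ ≤ a₁ →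
      ∀ U : (bg9Y (Matrix (Fin N) (Fin N) ℂ) (specialUnitaryUnits (Fin N)) x).Cfg, (bg9Y (Matrix (Fin N) (Fin N) ℂ) (specialUnitaryUnits (Fin N)) x).Reg335 c35Y α₀ U →
        HolderLegs310 (𝔬 x) (𝔭 x) (R x) (H x) (SH x) Bl δ₀ U ∧ FactorsHolder310 (𝔬 x) (𝔭 x) (R x) (H x) θH δ₀ U)
    (hcntH : ∀ (x : MemberY θ₃.d₆ θ₃.ℓ₆ θ₃.hd' θ₃.hL' θ₃.b₀ θ₃.b₁ Mstar) (a : (geo9Y x).Site), (∑ q, if a ∈ SH x q then (1 : ℝ) else 0) ≤ NH)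
    (hBl : ∀ β, 0 ≤ β → β < 1 → 0 ≤ Bl β) (hθH : ∀ β, 0 ≤ β → β < 1 → 0 ≤ θH β)
    (ev : ∀ x : MemberY θ₃.d₆ θ₃.ℓ₆ θ₃.hd' θ₃.hL' θ₃.b₀ θ₃.b₁ Mstar, (geo9Y x).Loc → X x → ℝ) (evY : ∀ x : MemberY θ₃.d₆ θ₃.ℓ₆ θ₃.hd' θ₃.hL' θ₃.b₀ θ₃.b₁ Mstar, (geo9Y x).Loc → Y x → ℝ)
    (hco0 : ∀ x U, CoRealizes (ops x).GA 0 U (𝔬 x).blk (𝔬 x).blk (ev x) ((𝔬 x).G U))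
    (hco1 : ∀ x U, CoRealizes (ops x).GA 1 U (𝔬 x).blkY (𝔬 x).blk (ev x) ((𝔬 x).D U ∘ₗ (𝔬 x).G U))
    (hco2 : ∀ x U, CoRealizes (ops x).GA 2 U (𝔬 x).blk (𝔬 x).blkY (evY x) ((𝔬 x).G U ∘ₗ (𝔬 x).Dstar U))
    (hco3 : ∀ x U, CoRealizes (ops x).GA 3 U (𝔬 x).blk (𝔬 x).blk (ev x) ((𝔬 x).Lap U ∘ₗ (𝔬 x).G U))
    (hgl0 : ∀ x U, GlobReads (ops x).GA 0 U (𝔬 x).blk (𝔬 x).blk (ev x) ((𝔬 x).G U))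
    (hgl1 : ∀ x U, GlobReads (ops x).GA 1 U (𝔬 x).blkY (𝔬 x).blk (ev x) ((𝔬 x).D U ∘ₗ (𝔬 x).G U))
    (hgl2 : ∀ x U, GlobReads (ops x).GA 2 U (𝔬 x).blk (𝔬 x).blkY (evY x) ((𝔬 x).G U ∘ₗ (𝔬 x).Dstar U))
    (hgl3 : ∀ x U, GlobReads (ops x).GA 3 U (𝔬 x).blk (𝔬 x).blk (ev x) ((𝔬 x).Lap U ∘ₗ (𝔬 x).G U))
    (hl0 : ∀ x U, L2Reads (R := R x) (H := H x) (ops x).GA 0 U (𝔬 x).blk (𝔬 x).blk (ev x) ((𝔬 x).G U))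
    (hl1 : ∀ x U, L2Reads (R := R x) (H := H x) (ops x).GA 1 U (𝔬 x).blkY (𝔬 x).blk (ev x) ((𝔬 x).D U ∘ₗ (𝔬 x).G U))
    (hl2 : ∀ x U, L2Reads (R := R x) (H := H x) (ops x).GA 2 U (𝔬 x).blk (𝔬 x).blkY (evY x) ((𝔬 x).G U ∘ₗ (𝔬 x).Dstar U))
    (hH1 : ∀ x U, H1Reads (ops x).GA U (𝔭 x) (𝔬 x).blk (𝔬 x).blkY (ev x) (evY x) ((𝔬 x).D U ∘ₗ (𝔬 x).G U) ((𝔬 x).G U ∘ₗ (𝔬 x).Dstar U))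
    (hsym : ∀ x U, IsTransposePair ((𝔬 x).G U) ((𝔬 x).G U))
    (htr : ∀ x U, IsTransposePair ((𝔬 x).D U ∘ₗ (𝔬 x).G U) ((𝔬 x).G U ∘ₗ (𝔬 x).Dstar U))
    {dF : ℕ} {αF L₀ B₁ δ₁ Mg Mr ar : ℝ} {Bβ Bε : ℝ → ℝ} {Bεβ : ℝ → ℝ → ℝ}
    (hfacts : ∀ x : MemberY θ₃.d₆ θ₃.ℓ₆ θ₃.hd' θ₃.hL' θ₃.b₀ θ₃.b₁ Mstar, Mg ≤ (geo9Y x).M → Facts347 (geo9Y x) (R x) (H x) dF ((1 - 2 * α) * δ₀) αF L₀)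
    (hCB : (const37 d δ₀ α ρ B₀ Nc N' Cℓ K) ≤ B₁) (hCL : (const37 d δ₀ α ρ B₀ Nc N' Cℓ K) * L₀ ≤ B₁) (hδ₁ : δ₁ ≤ (1 - αF) * ((1 - 2 * α) * δ₀)) (hαF : 0 ≤ αF * ((1 - 2 * α) * δ₀))
    (hCg : (const37 d δ₀ α ρ B₀ Nc N' Cℓ K) * B6.c1 dF ((1 - 2 * α) * δ₀) (1 - αF) * L₀ ^ (4 : ℝ) ≤ B₁) (har : 0 < ar)
    (hBβ : ∀ β, 0 ≤ β → β < 1 → holderConst d δ₀ α NH NF (const37 d δ₀ α ρ B₀ Nc N' Cℓ K) (Bl β) (θH β) ≤ Bβ β)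
    (hrest : ∀ x : MemberY θ₃.d₆ θ₃.ℓ₆ θ₃.hd' θ₃.hL' θ₃.b₀ θ₃.b₁ Mstar, Mr ≤ (geo9Y x).M → ∀ α₀ : ℝ, 0 < α₀ → (geo9Y x).M * α₀ ≤ ar → ∀ U : (bg9Y (Matrix (Fin N) (Fin N) ℂ) (specialUnitaryUnits (Fin N)) x).Cfg, (bg9Y (Matrix (Fin N) (Fin N) ℂ) (specialUnitaryUnits (Fin N)) x).Reg335 c35Y α₀ U →
      (∀ (ε : ℝ) (lam : (geo9Y x).Loc) (y y' : (geo9Y x).Site), 0 < ε → ε ≤ 1 → (geo9Y x).suppInT lam y' →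
          (ops x).GA.e4 U lam y ≤ Bε ε * Real.exp (-(δ₁ * (geo9Y x).dist y y')) * ((geo9Y x).holder ε lam + (geo9Y x).supNorm lam)) ∧
        (∀ (ε β : ℝ) (lam : (geo9Y x).Loc) (ζ : (geo9Y x).Cut) (y y' : (geo9Y x).Site), 0 < ε → ε ≤ 1 → 0 ≤ β → β < 1 →
          (geo9Y x).cutInT ζ y → (geo9Y x).suppInT lam y' →
          (ops x).GA.h2 U lam β ζ ≤ Bεβ ε β * ((geo9Y x).len y) ^ (-β) * (geo9Y x).cutH β ζ *
            Real.exp (-(δ₁ * (geo9Y x).dist y y')) * ((geo9Y x).holder (β + ε) lam + (geo9Y x).supNorm lam)) ∧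
        ∀ (n : Fin 6), 3 ≤ n.val → ∀ (lam : (geo9Y x).Loc) (h : (geo9Y x).Cut) (y y' : (geo9Y x).Site), (geo9Y x).cutIn h y →
          (geo9Y x).suppIn lam y' →
          (ops x).GA.l2 n U lam h ≤ B₁ * B9.pref6 ((geo9Y x).len y) n * (geo9Y x).cutSup h * Real.exp (-(δ₁ * (geo9Y x).dist y y')) *
            (geo9Y x).l2Norm lam)
    (hE310 : ∀ x : MemberY θ₃.d₆ θ₃.ℓ₆ θ₃.hd' θ₃.hL' θ₃.b₀ θ₃.b₁ Mstar, (ops x).E310 = W310OfOps (𝔬 x) (rd x) (ConvAll3107 (𝔬 x) (R x) (H x) (const37 d δ₀ α ρ B₀ Nc N' Cℓ K) ((1 - 2 * α) * δ₀) (ops x).GA B₁ δ₁ Bβ Bε Bεβ)) :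
    B9.Thm310Printed c35Y geo9Y (bg9Y (Matrix (Fin N) (Fin N) ℂ) (specialUnitaryUnits (Fin N))) (fun x => (ops x).E310) := by
  have hfun : (fun x => (ops x).E310) = fun x => W310OfOps (𝔬 x) (rd x) (ConvAll3107 (𝔬 x) (R x) (H x) (const37 d δ₀ α ρ B₀ Nc N' Cℓ K) ((1 - 2 * α) * δ₀) (ops x).GA B₁ δ₁ Bβ Bε Bεβ) :=
    funext hE310
  rw [hfun]
  have h310 := thm310Printed_of_local3107 𝔬 rd R H κ d α ρ Nc N' NF Cℓ K θ₀ B₀ δ₀ a₁ M₁ ML c35Y_pos hα hα2 hN hN' hNF hCℓ hK hθ₀ hB₀ hδ₀ ha₁ hM₁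
    hst hκ hrd hloc h261 h36
  have hα1 : α ≤ 1 := by linarith
  have hδδ : (1 - 2 * α) * δ₀ ≤ (1 - α) * δ₀ := by nlinarith
  have hδnn : 0 ≤ (1 - 2 * α) * δ₀ := by nlinarith
  exact thm310Printed_allPin_schur_holder 𝔭 (fun x => (ops x).GA) ev evY κ SH Bl θH d δ₀ α ρ Nc N' NF Cℓ θ₀ NH a₁ M₁ ML h310 hco0 hco1 hco2 hco3
    hgl0 hgl1 hgl2 hgl3 hl0 hl1 hl2 hH1 hsym htr hfacts (fun x => geo9Y_dist_comm x) (const37_nonneg d hB₀.le hN hN' hCℓ hK) hCB hCL hδ₁ hαF hCg har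
    c35Y_pos ha₁ hα hα1 hNF hθ₀ hNH hδnn hδδ hδ₀.le hst hcntH hBl hθH hBβ h261
    (fun x hM α₀ hα₀ ha U hU => ⟨(h36 x hM α₀ hα₀ ha U hU).2.1, (h36 x hM α₀ hα₀ ha U hU).2.2, (h36H x hM α₀ hα₀ ha U hU).1, (h36H x hM α₀ hα₀ ha U hU).2⟩)
    hrest

/-! ## `t37` at the all-blocks pin of `E37`, (3.43) member proved (n06-k's G′ twin `B9RWSums343HolderGp`) -/

/-- ★ **`t37` AT THE ALL-BLOCKS PIN, (3.43) MEMBER PROVED** `(ops x).E37 = E37AllOfOps (W38OfOps (𝔬 x) (rd x) (R x) (H x) C δ) (𝔬 x) (R x) (H x) C δ (ops x).Gp B₁ δ₁ B(·) B′(·) B′(·,·)`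
(C = `const37 …`, δ = (1−2α)δ₀): n06-c's walk-pin inputs give Theorem 3.7 at `W38OfOps …` (`thm37Printed_W38OfOps_of_local342`), and n06-k's `thm37Printed_allPin_schur_holder`
strengthens the predicate to all blocks from the co-readings of `(ops x).Gp` (sup ∕ weighted ∕ L² ∕ Hölder-through-probes `hH1`), the symmetry of G′(U) and the transpose pair, the
member facts `Facts347` for M ≧ M_g, Cor. 3.6's Hölder legs for the head terms h_□G′_□(U)h_□ and the V-terms through the probes (`h36H` = `HolderLegs37` ∧ `HolderV37`, at
`h36`'s thresholds and rate), the constants' relations (`hBβ`) and the residual (3.44), (3.45), (3.46)₃,₄,₅ under the provisos — all displayed.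
[cite: Balaban1985BackgroundPropagators, Thm 3.7 p.409, Thm 3.7 ⇒ Thm 3.1 p.410, Cor. 3.6 p.408, (3.40) p.397, (3.42)–(3.47) pp.397–398; Balaban1984PropagatorsII, Lemma 2.1 (2.60)–(2.61) p.234] -/
theorem t37_of_allPin_holder [∀ x : MemberY θ₃.d₆ θ₃.ℓ₆ θ₃.hd' θ₃.hL' θ₃.b₀ θ₃.b₁ Mstar, Fintype (geo9Y x).Site] [∀ x : MemberY θ₃.d₆ θ₃.ℓ₆ θ₃.hd' θ₃.hL' θ₃.b₀ θ₃.b₁ Mstar, DecidableEq (geo9Y x).Site]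
    {X Y ι PX PY : MemberY θ₃.d₆ θ₃.ℓ₆ θ₃.hd' θ₃.hL' θ₃.b₀ θ₃.b₁ Mstar → Type} [∀ x, Fintype (X x)] [∀ x, DecidableEq (X x)] [∀ x, Fintype (Y x)] [∀ x, DecidableEq (Y x)]
    [∀ x, Fintype (ι x)] [∀ x, Fintype (PX x)] [∀ x, DecidableEq (PX x)] [∀ x, Fintype (PY x)] [∀ x, DecidableEq (PY x)]
    (𝔬 : ∀ x, Ops (geo9Y x) (bg9Y (Matrix (Fin N) (Fin N) ℂ) (specialUnitaryUnits (Fin N)) x) (X x) (Y x) (ι x)) (rd : ∀ x, WalkReading (geo9Y x) (bg9Y (Matrix (Fin N) (Fin N) ℂ) (specialUnitaryUnits (Fin N)) x) (X x) (ι x))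
    (𝔭 : ∀ x : MemberY θ₃.d₆ θ₃.ℓ₆ θ₃.hd' θ₃.hL' θ₃.b₀ θ₃.b₁ Mstar, HolderProbes (geo9Y x) (bg9Y (Matrix (Fin N) (Fin N) ℂ) (specialUnitaryUnits (Fin N)) x) (X x) (Y x) (PX x) (PY x))
    (SH : ∀ x : MemberY θ₃.d₆ θ₃.ℓ₆ θ₃.hd' θ₃.hL' θ₃.b₀ θ₃.b₁ Mstar, ι x → Finset (geo9Y x).Site) (Bl BV : ℝ → ℝ) (NH : ℝ)
    (R : MemberY θ₃.d₆ θ₃.ℓ₆ θ₃.hd' θ₃.hL' θ₃.b₀ θ₃.b₁ Mstar → ℝ) (H : MemberY θ₃.d₆ θ₃.ℓ₆ θ₃.hd' θ₃.hL' θ₃.b₀ θ₃.b₁ Mstar → Prop) (κ : MemberY θ₃.d₆ θ₃.ℓ₆ θ₃.hd' θ₃.hL' θ₃.b₀ θ₃.b₁ Mstar → Sizes) (d : ℕ) (α ρ Nc N' Cℓ K θ₀ B₀ δ₀ a₁ M₁ ML : ℝ)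
    (hα : 0 ≤ α) (hα2 : α ≤ 1 / 2) (hN : 0 ≤ Nc) (hN' : 0 ≤ N') (hCℓ : 1 ≤ Cℓ) (hK : 0 ≤ K) (hB₀ : 0 ≤ B₀) (hδ₀ : 0 ≤ δ₀) (ha₁ : 0 < a₁) (hM₁ : 0 < M₁)
    (hNH : 0 ≤ NH)
    (hst : ∀ x, StaticOK (𝔬 x) ρ Nc N' Cℓ (κ x)) (hκ : ∀ x, (κ x).Bounded K θ₀ Cℓ (geo9Y x).M)
    (h261 : ∀ x : MemberY θ₃.d₆ θ₃.ℓ₆ θ₃.hd' θ₃.hL' θ₃.b₀ θ₃.b₁ Mstar, ML ≤ (geo9Y x).M → Ineq261 d (toB6 (geo9Y x) (R x) (H x)) δ₀ α)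
    (h36 : ∀ x : MemberY θ₃.d₆ θ₃.ℓ₆ θ₃.hd' θ₃.hL' θ₃.b₀ θ₃.b₁ Mstar, M₁ ≤ (geo9Y x).M → ∀ α₀ : ℝ, 0 < α₀ → c35Y * (geo9Y x).M * α₀ ≤ a₁ →
      ∀ U : (bg9Y (Matrix (Fin N) (Fin N) ℂ) (specialUnitaryUnits (Fin N)) x).Cfg, (bg9Y (Matrix (Fin N) (Fin N) ℂ) (specialUnitaryUnits (Fin N)) x).Reg335 c35Y α₀ U → Local342 (𝔬 x) (R x) (H x) B₀ δ₀ U ∧ Identities (𝔬 x) (R x) (H x) U)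
    (h36H : ∀ x : MemberY θ₃.d₆ θ₃.ℓ₆ θ₃.hd' θ₃.hL' θ₃.b₀ θ₃.b₁ Mstar, M₁ ≤ (geo9Y x).M → ∀ α₀ : ℝ, 0 < α₀ → c35Y * (geo9Y x).M * α₀ ≤ a₁ →
      ∀ U : (bg9Y (Matrix (Fin N) (Fin N) ℂ) (specialUnitaryUnits (Fin N)) x).Cfg, (bg9Y (Matrix (Fin N) (Fin N) ℂ) (specialUnitaryUnits (Fin N)) x).Reg335 c35Y α₀ U →
        HolderLegs37 (𝔬 x) (𝔭 x) (R x) (H x) (SH x) Bl δ₀ U ∧ HolderV37 (𝔬 x) (𝔭 x) (R x) (H x) BV δ₀ U)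
    (hcntH : ∀ (x : MemberY θ₃.d₆ θ₃.ℓ₆ θ₃.hd' θ₃.hL' θ₃.b₀ θ₃.b₁ Mstar) (a : (geo9Y x).Site), (∑ q, if a ∈ SH x q then (1 : ℝ) else 0) ≤ NH)
    (hBl : ∀ β, 0 ≤ β → β < 1 → 0 ≤ Bl β) (hBV : ∀ β, 0 ≤ β → β < 1 → 0 ≤ BV β)
    (ev : ∀ x : MemberY θ₃.d₆ θ₃.ℓ₆ θ₃.hd' θ₃.hL' θ₃.b₀ θ₃.b₁ Mstar, (geo9Y x).Loc → X x → ℝ) (evY : ∀ x : MemberY θ₃.d₆ θ₃.ℓ₆ θ₃.hd' θ₃.hL' θ₃.b₀ θ₃.b₁ Mstar, (geo9Y x).Loc → Y x → ℝ)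
    (hco0 : ∀ x U, CoRealizes (ops x).Gp 0 U (𝔬 x).blk (𝔬 x).blk (ev x) ((𝔬 x).Gp U))
    (hco1 : ∀ x U, CoRealizes (ops x).Gp 1 U (𝔬 x).blkY (𝔬 x).blk (ev x) ((𝔬 x).D U ∘ₗ (𝔬 x).Gp U))
    (hco2 : ∀ x U, CoRealizes (ops x).Gp 2 U (𝔬 x).blk (𝔬 x).blkY (evY x) ((𝔬 x).Gp U ∘ₗ (𝔬 x).Dstar U))
    (hco3 : ∀ x U, CoRealizes (ops x).Gp 3 U (𝔬 x).blk (𝔬 x).blk (ev x) ((𝔬 x).Lap U ∘ₗ (𝔬 x).Gp U))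
    (hgl0 : ∀ x U, GlobReads (ops x).Gp 0 U (𝔬 x).blk (𝔬 x).blk (ev x) ((𝔬 x).Gp U))
    (hgl1 : ∀ x U, GlobReads (ops x).Gp 1 U (𝔬 x).blkY (𝔬 x).blk (ev x) ((𝔬 x).D U ∘ₗ (𝔬 x).Gp U))
    (hgl2 : ∀ x U, GlobReads (ops x).Gp 2 U (𝔬 x).blk (𝔬 x).blkY (evY x) ((𝔬 x).Gp U ∘ₗ (𝔬 x).Dstar U))
    (hgl3 : ∀ x U, GlobReads (ops x).Gp 3 U (𝔬 x).blk (𝔬 x).blk (ev x) ((𝔬 x).Lap U ∘ₗ (𝔬 x).Gp U))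
    (hl0 : ∀ x U, L2Reads (R := R x) (H := H x) (ops x).Gp 0 U (𝔬 x).blk (𝔬 x).blk (ev x) ((𝔬 x).Gp U))
    (hl1 : ∀ x U, L2Reads (R := R x) (H := H x) (ops x).Gp 1 U (𝔬 x).blkY (𝔬 x).blk (ev x) ((𝔬 x).D U ∘ₗ (𝔬 x).Gp U))
    (hl2 : ∀ x U, L2Reads (R := R x) (H := H x) (ops x).Gp 2 U (𝔬 x).blk (𝔬 x).blkY (evY x) ((𝔬 x).Gp U ∘ₗ (𝔬 x).Dstar U))
    (hH1 : ∀ x U, H1Reads (ops x).Gp U (𝔭 x) (𝔬 x).blk (𝔬 x).blkY (ev x) (evY x) ((𝔬 x).D U ∘ₗ (𝔬 x).Gp U) ((𝔬 x).Gp U ∘ₗ (𝔬 x).Dstar U))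
    (hsym : ∀ x U, IsTransposePair ((𝔬 x).Gp U) ((𝔬 x).Gp U))
    (htr : ∀ x U, IsTransposePair ((𝔬 x).D U ∘ₗ (𝔬 x).Gp U) ((𝔬 x).Gp U ∘ₗ (𝔬 x).Dstar U))
    {dF : ℕ} {αF L₀ B₁ δ₁ Mg Mr ar : ℝ} {Bβ Bε : ℝ → ℝ} {Bεβ : ℝ → ℝ → ℝ}
    (hfacts : ∀ x : MemberY θ₃.d₆ θ₃.ℓ₆ θ₃.hd' θ₃.hL' θ₃.b₀ θ₃.b₁ Mstar, Mg ≤ (geo9Y x).M → Facts347 (geo9Y x) (R x) (H x) dF ((1 - 2 * α) * δ₀) αF L₀)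
    (hCB : (const37 d δ₀ α ρ B₀ Nc N' Cℓ K) ≤ B₁) (hCL : (const37 d δ₀ α ρ B₀ Nc N' Cℓ K) * L₀ ≤ B₁) (hδ₁ : δ₁ ≤ (1 - αF) * ((1 - 2 * α) * δ₀)) (hαF : 0 ≤ αF * ((1 - 2 * α) * δ₀))
    (hCg : (const37 d δ₀ α ρ B₀ Nc N' Cℓ K) * B6.c1 dF ((1 - 2 * α) * δ₀) (1 - αF) * L₀ ^ (4 : ℝ) ≤ B₁) (har : 0 < ar)
    (hBβ : ∀ β, 0 ≤ β → β < 1 → holderConst d δ₀ α NH N' (const37 d δ₀ α ρ B₀ Nc N' Cℓ K) (Bl β) (BV β) ≤ Bβ β)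
    (hrest : ∀ x : MemberY θ₃.d₆ θ₃.ℓ₆ θ₃.hd' θ₃.hL' θ₃.b₀ θ₃.b₁ Mstar, Mr ≤ (geo9Y x).M → ∀ α₀ : ℝ, 0 < α₀ → (geo9Y x).M * α₀ ≤ ar → ∀ U : (bg9Y (Matrix (Fin N) (Fin N) ℂ) (specialUnitaryUnits (Fin N)) x).Cfg, (bg9Y (Matrix (Fin N) (Fin N) ℂ) (specialUnitaryUnits (Fin N)) x).Reg335 c35Y α₀ U →
      (∀ (ε : ℝ) (lam : (geo9Y x).Loc) (y y' : (geo9Y x).Site), 0 < ε → ε ≤ 1 → (geo9Y x).suppInT lam y' →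
          (ops x).Gp.e4 U lam y ≤ Bε ε * Real.exp (-(δ₁ * (geo9Y x).dist y y')) * ((geo9Y x).holder ε lam + (geo9Y x).supNorm lam)) ∧
        (∀ (ε β : ℝ) (lam : (geo9Y x).Loc) (ζ : (geo9Y x).Cut) (y y' : (geo9Y x).Site), 0 < ε → ε ≤ 1 → 0 ≤ β → β < 1 →
          (geo9Y x).cutInT ζ y → (geo9Y x).suppInT lam y' →
          (ops x).Gp.h2 U lam β ζ ≤ Bεβ ε β * ((geo9Y x).len y) ^ (-β) * (geo9Y x).cutH β ζ *
            Real.exp (-(δ₁ * (geo9Y x).dist y y')) * ((geo9Y x).holder (β + ε) lam + (geo9Y x).supNorm lam)) ∧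
        ∀ (n : Fin 6), 3 ≤ n.val → ∀ (lam : (geo9Y x).Loc) (h : (geo9Y x).Cut) (y y' : (geo9Y x).Site), (geo9Y x).cutIn h y →
          (geo9Y x).suppIn lam y' →
          (ops x).Gp.l2 n U lam h ≤ B₁ * B9.pref6 ((geo9Y x).len y) n * (geo9Y x).cutSup h * Real.exp (-(δ₁ * (geo9Y x).dist y y')) *
            (geo9Y x).l2Norm lam)
    (hE37 : ∀ x : MemberY θ₃.d₆ θ₃.ℓ₆ θ₃.hd' θ₃.hL' θ₃.b₀ θ₃.b₁ Mstar, (ops x).E37 = E37AllOfOps (W38OfOps (𝔬 x) (rd x) (R x) (H x) (const37 d δ₀ α ρ B₀ Nc N' Cℓ K) ((1 - 2 * α) * δ₀)) (𝔬 x) (R x) (H x) (const37 d δ₀ α ρ B₀ Nc N' Cℓ K) ((1 - 2 * α) * δ₀) (ops x).Gp B₁ δ₁ Bβ Bε Bεβ) :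
    B9.Thm37Printed c35Y geo9Y (bg9Y (Matrix (Fin N) (Fin N) ℂ) (specialUnitaryUnits (Fin N))) (fun x => (ops x).E37) := by
  have hfun : (fun x => (ops x).E37) = fun x => E37AllOfOps (W38OfOps (𝔬 x) (rd x) (R x) (H x) (const37 d δ₀ α ρ B₀ Nc N' Cℓ K) ((1 - 2 * α) * δ₀)) (𝔬 x) (R x) (H x) (const37 d δ₀ α ρ B₀ Nc N' Cℓ K) ((1 - 2 * α) * δ₀) (ops x).Gp B₁ δ₁ Bβ Bε Bεβ :=
    funext hE37
  rw [hfun]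
  have h37 := thm37Printed_W38OfOps_of_local342 𝔬 rd R H κ d α ρ Nc N' Cℓ K θ₀ B₀ δ₀ a₁ M₁ ML c35Y_pos hα hα2 hN hN' hCℓ hK hB₀ hδ₀ ha₁ hM₁ hst hκ h261 h36
  have hα1 : α ≤ 1 := by linarith
  have hδδ : (1 - 2 * α) * δ₀ ≤ (1 - α) * δ₀ := by nlinarith
  have hδnn : 0 ≤ (1 - 2 * α) * δ₀ := by nlinarith
  exact thm37Printed_allPin_schur_holder (𝔴 := fun x => (W38OfOps (𝔬 x) (rd x) (R x) (H x) (const37 d δ₀ α ρ B₀ Nc N' Cℓ K) ((1 - 2 * α) * δ₀))) 𝔭 (fun x => (ops x).Gp) ev evY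
    κ SH Bl BV d δ₀ α ρ Nc N' Cℓ K θ₀ B₀ NH a₁ M₁ ML h37 hco0 hco1 hco2 hco3 hgl0 hgl1 hgl2 hgl3 hl0 hl1 hl2 hH1 hsym htr hfacts (fun x => geo9Y_dist_comm x)
    (const37_nonneg d hB₀ hN hN' hCℓ hK) hCB hCL hδ₁ hαF hCg har c35Y_pos ha₁ hα hα1 hN' hB₀ hNH hM₁ hδnn hδδ hδ₀ hst hκ hcntH hBl hBV hBβ h261
    (fun x hM α₀ hα₀ ha U hU => ⟨(h36 x hM α₀ hα₀ ha U hU).1, (h36 x hM α₀ hα₀ ha U hU).2, (h36H x hM α₀ hα₀ ha U hU).1, (h36H x hM α₀ hα₀ ha U hU).2⟩)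
    hrest

end Summit.QuantumFields.YangMills.BalabanUVNodes.N06AtRecord11ObligationsPins5

end
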